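import Summits.AtomisticToContinuum.HydrodynamicLimit.Theorems.AntiMazurCoboundariesCorrectorPressureDecayTangentTightnessLaplace
import Literature.Analysis.FunctionSpaces.PointConfigVagueTopology
import Literature.MathematicalPhysics.KineticTheory.CollisionTubePullbackPacking

/-!
# Bias continuity along tangent states, 0: the one-body limit (line `FirstLemma`, crux stmt-AtomisticToContinuum-14135)

Helper file of crux stmt-AtomisticToContinuum-14135 `AntiMazurCoboundaries.CorrectorPressureDecay`, line `FirstLemma`
(idea `kifer-compactification`), namespace `…Theorems.KiferCompactification`; registered stub `stub_oneBodyLimit`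
(hypothesis `h₁` of `stub_tangentBiasOfFacts`, `…TangentBias.lean`): along a tangent state `μ` of a tangent family,
for `h ∈ C_c(ℝ³ × ℝ³)` the linear statistic `ω ↦ ∑_{p ∈ ω} h p` is `μ`-integrable and
`(∫φ)⁻¹ ∫ φ(x) E_{Q(ι k)}[∑ᵢ h(blowUpPoint ε x zᵢ)] dx → E_μ[∑_{p ∈ ω} h p]` (Kallenberg Thm. 16.16 in this frame,
the uniform integrability being supplied by the hard core). Route: the finite-`N` expectation is `E_{P_k}[∑ h]` for
the blown-up law `P_k = blowUpLaw σ φ (N (ι k)) (Q (ι k))` (`integral_sumFn_blowUpLaw`); `P_k`-a.s. configurations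
are `1`-hard-core, whence `|∑_{p ∈ ω} h p| ≤ C(h)` (`ae_isHardCore_blowUpLaw`, `exists_sumFn_bound_of_isHardCore`,
packing); the abstract `tendsto_integral_of_tendsto_integral_exp` (`S ≥ 0` bounded a.s. under probability laws `P_k`
with `E_{P_k}[e^{-tS}] → E_μ[e^{-tS}]`, `t > 0`, is `μ`-integrable with `E_{P_k}[S] → E_μ[S]`: difference quotients
`(1 - e^{-tS})/t`, Fatou, dominated convergence) applied to `h⁺`, `h⁻`.
References: Kallenberg, *Foundations of Modern Probability* (2002), Thm. 16.16; Olla–Varadhan–Yau 1993 §4.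
-/

noncomputable section

open MeasureTheory ProbabilityTheory Set Filter Topology
open scoped ENNReal NNReal

namespace Summit.AtomisticToContinuum.HydrodynamicLimit.Theorems.KiferCompactification

open Literature.MathematicalPhysics.KineticTheory (T3 V3 hsDiameter hsDiameter_pos localGibbsLaw blowUpPoint
  blowUp card_le_of_separated)
open Literature.MathematicalPhysics.KineticTheory.PointProcess (laplaceFunctional finsum_mem_eq_toReal_tsum)
open Literature.Analysis.FluidPDE (HardSphereFlow Config IsHardCore hardSphereDomain)
open Literature.Analysis.FunctionSpaces (PointConfig)
open Literature.Analysis.FunctionSpaces.PointConfig (sumFn_def sumFn_eq_sum sumFn_add sumFn_nonneg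
  finite_inter_support measurable_tsum_carrier)

/-! ## Expectations from Laplace transforms under a uniform bound -/

/-- For `s ≥ 0 < t`: `0 ≤ (1 - e^{-ts})/t ≤ s`. -/
private theorem laplaceQuot_mem {s t : ℝ} (hs : 0 ≤ s) (ht : 0 < t) :
    0 ≤ (1 - Real.exp (-(t * s))) / t ∧ (1 - Real.exp (-(t * s))) / t ≤ s := by
  refine ⟨div_nonneg (sub_nonneg.2 (Real.exp_le_one_iff.2 (neg_nonpos.2 (by positivity)))) ht.le, ?_⟩
  rw [div_le_iff₀ ht]
  linarith [Real.add_one_le_exp (-(t * s)), mul_comm s t]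

/-- For `s ≥ 0 < t` with `ts ≤ 1`: `|s - (1 - e^{-ts})/t| ≤ t s²`. -/
private theorem abs_sub_laplaceQuot_le {s t : ℝ} (hs : 0 ≤ s) (ht : 0 < t) (hst : t * s ≤ 1) :
    |s - (1 - Real.exp (-(t * s))) / t| ≤ t * s ^ 2 := by
  have h1 : |Real.exp (-(t * s)) - 1 - (-(t * s))| ≤ (-(t * s)) ^ 2 :=
    Real.abs_exp_sub_one_sub_id_le (by rw [abs_neg, abs_of_nonneg (by positivity)]; exact hst)
  have h2 : s - (1 - Real.exp (-(t * s))) / t = (Real.exp (-(t * s)) - 1 - (-(t * s))) / t := by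
    field_simp
    ring
  rw [h2, abs_div, abs_of_pos ht, div_le_iff₀ ht]
  exact h1.trans_eq (by ring)

/-- **Expectations from Laplace transforms under a uniform bound.** If `S ≥ 0` is measurable, bounded by `C` almost
surely under each probability law `P k`, and `E_{P k}[e^{-tS}] → E_μ[e^{-tS}]` for every `t > 0` (`μ` a probability
law), then `S ∈ L¹(μ)` and `E_{P k}[S] → E_μ[S]`. With `g_t = (1 - e^{-tS})/t`: `0 ≤ g_t ≤ S`, `|S - g_t| ≤ t C²`
where `S ≤ C` and `tC ≤ 1`, `E_{P k}[g_t] → E_μ[g_t] ≤ C`; Fatou along `g_{1/(n+1)} → S` and dominated convergence. -/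
theorem tendsto_integral_of_tendsto_integral_exp {Ω : Type*} [MeasurableSpace Ω] {P : ℕ → Measure Ω}
    (hP : ∀ k, IsProbabilityMeasure (P k)) {μ : Measure Ω} [IsProbabilityMeasure μ] {S : Ω → ℝ}
    (hS : Measurable S) (hS0 : ∀ ω, 0 ≤ S ω) {C : ℝ} (hC : ∀ k, ∀ᵐ ω ∂P k, S ω ≤ C)
    (hL : ∀ t : ℝ, 0 < t →
      Tendsto (fun k => ∫ ω, Real.exp (-(t * S ω)) ∂P k) atTop (𝓝 (∫ ω, Real.exp (-(t * S ω)) ∂μ))) :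
    Integrable S μ ∧ Tendsto (fun k => ∫ ω, S ω ∂P k) atTop (𝓝 (∫ ω, S ω ∂μ)) := by
  -- the difference quotients `g t = (1 - e^{-tS})/t`
  obtain ⟨g, hg⟩ : ∃ g : ℝ → Ω → ℝ, ∀ t ω, g t ω = (1 - Real.exp (-(t * S ω))) / t := ⟨_, fun _ _ => rfl⟩
  have hem : ∀ t, Measurable fun ω => Real.exp (-(t * S ω)) := fun t => (hS.const_mul t).neg.exp
  have hgm : ∀ t, Measurable (g t) := fun t => by
    rw [show g t = fun ω => (1 - Real.exp (-(t * S ω))) / t from funext (hg t)]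
    exact ((hem t).const_sub 1).div_const t
  have hei : ∀ (ν : Measure Ω) [IsFiniteMeasure ν] (t : ℝ), 0 < t →
      Integrable (fun ω => Real.exp (-(t * S ω))) ν := fun ν _ t ht =>
    Integrable.of_bound (hem t).aestronglyMeasurable 1 (ae_of_all _ fun ω => by
      rw [Real.norm_eq_abs, abs_of_nonneg (Real.exp_pos _).le, Real.exp_le_one_iff, neg_nonpos]
      exact mul_nonneg ht.le (hS0 ω))
  have hgi : ∀ (ν : Measure Ω) [IsFiniteMeasure ν] (t : ℝ), 0 < t → Integrable (g t) ν := fun ν _ t ht => by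
    rw [show g t = fun ω => (1 - Real.exp (-(t * S ω))) / t from funext (hg t)]
    exact ((integrable_const 1).sub (hei ν t ht)).div_const t
  have hgb : ∀ t, 0 < t → ∀ ω, 0 ≤ g t ω ∧ g t ω ≤ S ω := fun t ht ω => by
    rw [hg]; exact laplaceQuot_mem (hS0 ω) ht
  -- integrals of `g t` are `(1 - Laplace transform)/t`
  have hgint : ∀ ν : Measure Ω, IsProbabilityMeasure ν → ∀ t : ℝ, 0 < t →
      ∫ ω, g t ω ∂ν = (1 - ∫ ω, Real.exp (-(t * S ω)) ∂ν) / t := fun ν _ t ht => by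
    simp only [hg]
    rw [integral_div, integral_sub (integrable_const 1) (hei ν t ht), integral_const, probReal_univ, one_smul]
  -- (I) convergence of `E_{P k}[g t]`
  have hI : ∀ t, 0 < t → Tendsto (fun k => ∫ ω, g t ω ∂P k) atTop (𝓝 (∫ ω, g t ω ∂μ)) := fun t ht => by
    rw [hgint μ inferInstance t ht, show (fun k => ∫ ω, g t ω ∂P k) =
      fun k => (1 - ∫ ω, Real.exp (-(t * S ω)) ∂P k) / t from funext fun k => hgint (P k) (hP k) t ht]
    exact ((hL t ht).const_sub 1).div_const t
  -- (II) `E_{P k}[S]` is within `t C²` of `E_{P k}[g t]` once `t C ≤ 1`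
  have hII : ∀ k (t : ℝ), 0 < t → t * C ≤ 1 → |(∫ ω, S ω ∂P k) - ∫ ω, g t ω ∂P k| ≤ t * C ^ 2 := by
    intro k t ht htC
    haveI := hP k
    rw [← integral_sub (Integrable.of_bound hS.aestronglyMeasurable C ((hC k).mono fun ω hω => by
      rw [Real.norm_eq_abs, abs_of_nonneg (hS0 ω)]; exact hω)) (hgi _ t ht)]
    have h := norm_integral_le_of_norm_le_const (μ := P k) (C := t * C ^ 2) (f := fun ω => S ω - g t ω) ?_
    · rwa [probReal_univ, mul_one, Real.norm_eq_abs] at h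
    · filter_upwards [hC k] with ω hω
      rw [Real.norm_eq_abs, hg]
      have hst : t * S ω ≤ 1 := (mul_le_mul_of_nonneg_left hω ht.le).trans htC
      exact (abs_sub_laplaceQuot_le (hS0 ω) ht hst).trans
        (mul_le_mul_of_nonneg_left (pow_le_pow_left₀ (hS0 ω) hω 2) ht.le)
  -- (III) `E_μ[g t] ≤ C`
  have hIII : ∀ t, 0 < t → ∫ ω, g t ω ∂μ ≤ C := fun t ht => by
    refine le_of_tendsto' (hI t ht) fun k => ?_
    haveI := hP k
    calc ∫ ω, g t ω ∂P k ≤ ∫ _, C ∂P k :=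
          integral_mono_ae (hgi _ t ht) (integrable_const C) ((hC k).mono fun ω hω => (hgb t ht ω).2.trans hω)
      _ = C := by rw [integral_const, probReal_univ, one_smul]
  -- the sequence `t n = 1/(n+1)` and the pointwise convergence `g (t n) → S`
  obtain ⟨t, ht⟩ : ∃ t : ℕ → ℝ, ∀ n, t n = 1 / ((n : ℝ) + 1) := ⟨_, fun _ => rfl⟩
  have htpos : ∀ n, 0 < t n := fun n => by rw [ht]; exact Nat.one_div_pos_of_nat
  have ht0 : ∀ c : ℝ, Tendsto (fun n => t n * c) atTop (𝓝 0) := fun c => by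
    rw [show (0 : ℝ) = 0 * c from (zero_mul c).symm]
    refine Tendsto.mul_const c ?_
    rw [show t = fun n : ℕ => 1 / ((n : ℝ) + 1) from funext ht]
    exact tendsto_one_div_add_atTop_nhds_zero_nat
  have hgpt : ∀ ω, Tendsto (fun n => g (t n) ω) atTop (𝓝 (S ω)) := fun ω => by
    rw [← tendsto_sub_nhds_zero_iff]
    refine squeeze_zero_norm' (((ht0 (S ω)).eventually (eventually_le_nhds one_pos)).mono fun n hn => ?_)
      (ht0 (S ω ^ 2))
    rw [Real.norm_eq_abs, abs_sub_comm, hg]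
    exact abs_sub_laplaceQuot_le (hS0 ω) (htpos n) hn
  -- (IV) `S` is `μ`-integrable (Fatou)
  have hIV : Integrable S μ := by
    refine ⟨hS.aestronglyMeasurable, ?_⟩
    rw [hasFiniteIntegral_iff_ofReal (ae_of_all _ hS0),
      show (fun ω => ENNReal.ofReal (S ω)) = fun ω => liminf (fun n => ENNReal.ofReal (g (t n) ω)) atTop from
        funext fun ω => ((ENNReal.tendsto_ofReal (hgpt ω)).liminf_eq).symm]
    calc ∫⁻ ω, liminf (fun n => ENNReal.ofReal (g (t n) ω)) atTop ∂μ
        ≤ liminf (fun n => ∫⁻ ω, ENNReal.ofReal (g (t n) ω) ∂μ) atTop :=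
          lintegral_liminf_le fun n => (hgm (t n)).ennreal_ofReal
      _ ≤ ENNReal.ofReal C := by
          refine liminf_le_of_frequently_le (Frequently.of_forall fun n => ?_)
          rw [← ofReal_integral_eq_lintegral_ofReal (hgi μ (t n) (htpos n))
            (ae_of_all _ fun ω => (hgb (t n) (htpos n) ω).1)]
          exact ENNReal.ofReal_le_ofReal (hIII (t n) (htpos n))
      _ < ⊤ := ENNReal.ofReal_lt_top
  -- (V) `E_μ[g (t n)] → E_μ[S]` (dominated convergence)
  have hV : Tendsto (fun n => ∫ ω, g (t n) ω ∂μ) atTop (𝓝 (∫ ω, S ω ∂μ)) :=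
    tendsto_integral_of_dominated_convergence S (fun n => (hgm (t n)).aestronglyMeasurable) hIV
      (fun n => ae_of_all _ fun ω => by
        rw [Real.norm_eq_abs, abs_of_nonneg (hgb (t n) (htpos n) ω).1]
        exact (hgb (t n) (htpos n) ω).2)
      (ae_of_all _ hgpt)
  -- (VI) assembly: an `ε/3` argument
  refine ⟨hIV, Metric.tendsto_atTop.2 fun ε hε => ?_⟩
  have hε3 : 0 < ε / 3 := by positivity
  obtain ⟨n₁, hn₁⟩ := Metric.tendsto_atTop.1 hV (ε / 3) hε3
  obtain ⟨n₂, hn₂⟩ := eventually_atTop.1 (((ht0 (C ^ 2)).eventually (eventually_lt_nhds hε3)).and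
    ((ht0 C).eventually (eventually_le_nhds one_pos)))
  obtain ⟨K, hK⟩ := Metric.tendsto_atTop.1 (hI (t (max n₁ n₂)) (htpos _)) (ε / 3) hε3
  refine ⟨K, fun k hk => ?_⟩
  obtain ⟨h4, h5⟩ := hn₂ (max n₁ n₂) (le_max_right _ _)
  have h1 := hII k (t (max n₁ n₂)) (htpos _) h5
  have h2 := hK k hk
  have h3 := hn₁ (max n₁ n₂) (le_max_left _ _)
  rw [Real.dist_eq] at h2 h3 ⊢
  have e1 := abs_sub_le (∫ ω, S ω ∂P k) (∫ ω, g (t (max n₁ n₂)) ω ∂P k) (∫ ω, S ω ∂μ)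
  have e2 := abs_sub_le (∫ ω, g (t (max n₁ n₂)) ω ∂P k) (∫ ω, g (t (max n₁ n₂)) ω ∂μ) (∫ ω, S ω ∂μ)
  linarith

/-! ## Linear statistics on hard-core configurations -/

/-- The positive part of a compactly supported function has compact support. -/
private theorem hasCompactSupport_posPart {u : V3 × V3 → ℝ} (hcs : HasCompactSupport u) :
    HasCompactSupport fun p => max (u p) 0 :=
  hcs.comp_left (g := fun y : ℝ => max y 0) (max_self 0)

/-- The negative part of a compactly supported function has compact support. -/
private theorem hasCompactSupport_negPart {u : V3 × V3 → ℝ} (hcs : HasCompactSupport u) :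
    HasCompactSupport fun p => max (-u p) 0 :=
  hcs.comp_left (g := fun y : ℝ => max (-y) 0) (by rw [neg_zero, max_self])

/-- Linear statistics split along `u = u⁺ - u⁻`. -/
private theorem sumFn_eq_posPart_sub_negPart (ω : PointConfig (V3 × V3)) {u : V3 × V3 → ℝ}
    (hcs : HasCompactSupport u) :
    ω.sumFn u = ω.sumFn (fun p => max (u p) 0) - ω.sumFn (fun p => max (-u p) 0) := by
  have h : (fun p => max (u p) 0) = u + fun p => max (-u p) 0 := by
    funext p
    simp only [Pi.add_apply]
    linarith [max_zero_sub_max_neg_zero_eq_self (u p)]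
  have h2 := sumFn_add ω hcs (hasCompactSupport_negPart hcs)
  rw [← h] at h2
  linarith

/-- Linear statistics `ω ↦ ∑_{p ∈ ω} u p` of measurable compactly supported `u` are measurable for the count
σ-algebra (via `u = u⁺ - u⁻` and the Campbell measurability `PointConfig.measurable_tsum_carrier`). -/
theorem measurable_sumFn {u : V3 × V3 → ℝ} (hu : Measurable u) (hcs : HasCompactSupport u) :
    Measurable fun ω : PointConfig (V3 × V3) => ω.sumFn u := by
  have hpos : ∀ {w : V3 × V3 → ℝ}, Measurable w → HasCompactSupport w → (∀ p, 0 ≤ w p) →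
      Measurable fun ω : PointConfig (V3 × V3) => ω.sumFn w := by
    intro w hw hwc hw0
    rw [show (fun ω : PointConfig (V3 × V3) => ω.sumFn w) =
        fun ω : PointConfig (V3 × V3) => (∑' p : (ω : Set (V3 × V3)), ENNReal.ofReal (w p)).toReal from
      funext fun ω => by rw [sumFn_def, finsum_mem_eq_toReal_tsum hwc hw0 ω]]
    exact (measurable_tsum_carrier (f := fun q : PointConfig (V3 × V3) × (V3 × V3) => ENNReal.ofReal (w q.2))
      (ENNReal.measurable_ofReal.comp (hw.comp measurable_snd)) measurable_id).ennreal_toReal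
  rw [show (fun ω : PointConfig (V3 × V3) => ω.sumFn u) =
      fun ω => ω.sumFn (fun p => max (u p) 0) - ω.sumFn (fun p => max (-u p) 0) from
    funext fun ω => sumFn_eq_posPart_sub_negPart ω hcs]
  exact (hpos (hu.max measurable_const) (hasCompactSupport_posPart hcs) fun p => le_max_right _ _).sub
    (hpos (hu.neg.max measurable_const) (hasCompactSupport_negPart hcs) fun p => le_max_right _ _)

/-- **Hard-core bound on linear statistics.** For `u` continuous with compact support there is `C ≥ 0` with
`|∑_{p ∈ ω} u p| ≤ C` for every `1`-hard-core configuration `ω`: the points of `ω` in the support of `u` have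
`1`-separated positions of norm `≤ R`, hence are at most `(2R + 1)³` (`card_le_of_separated`). -/
theorem exists_sumFn_bound_of_isHardCore {u : V3 × V3 → ℝ} (hu : Continuous u) (hcs : HasCompactSupport u) :
    ∃ C : ℝ, 0 ≤ C ∧ ∀ ω : PointConfig (V3 × V3), IsHardCore 1 ω → |ω.sumFn u| ≤ C := by
  obtain ⟨B, hB⟩ := hu.bounded_above_of_compact_support hcs
  have hB0 : 0 ≤ B := (norm_nonneg _).trans (hB 0)
  obtain ⟨R, hR⟩ := hcs.isCompact.isBounded.subset_closedBall 0
  have hsupp : ∀ p, u p ≠ 0 → ‖p.1‖ ≤ max R 0 := fun p hp => by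
    have h := hR (subset_tsupport u hp)
    rw [Metric.mem_closedBall, dist_zero_right] at h
    exact (norm_fst_le p).trans (h.trans (le_max_left _ _))
  refine ⟨B * (2 * max R 0 / 1 + 1) ^ 3, by positivity, fun ω hω => ?_⟩
  rw [sumFn_eq_sum ω hcs]
  have hmem : ∀ p ∈ (ω.finite_inter_support hcs).toFinset, p ∈ ω ∧ u p ≠ 0 := fun p hp => by
    rw [Set.Finite.mem_toFinset] at hp
    exact ⟨hp.1, hp.2⟩
  have hcard : (((ω.finite_inter_support hcs).toFinset.card : ℕ) : ℝ) ≤ (2 * max R 0 / 1 + 1) ^ 3 :=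
    card_le_of_separated _ Prod.fst one_pos (le_max_right _ _) (fun p hp => hsupp p (hmem p hp).2)
      fun p hp p' hp' hne => hω p (hmem p hp).1 p' (hmem p' hp').1 hne
  calc |∑ p ∈ (ω.finite_inter_support hcs).toFinset, u p|
      ≤ ∑ p ∈ (ω.finite_inter_support hcs).toFinset, |u p| := Finset.abs_sum_le_sum_abs _ _
    _ ≤ ∑ _p ∈ (ω.finite_inter_support hcs).toFinset, B :=
        Finset.sum_le_sum fun p _ => by rw [← Real.norm_eq_abs]; exact hB p
    _ ≤ B * (2 * max R 0 / 1 + 1) ^ 3 := by rw [Finset.sum_const, nsmul_eq_mul, mul_comm]; gcongr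

/-- Laplace functionals of multiples of a test function: `L_ν(t u) = ∫ exp(-t ∑_{p ∈ ω} u p) dν`. -/
private theorem laplaceFunctional_const_mul (ν : Measure (PointConfig (V3 × V3))) (u : V3 × V3 → ℝ) (t : ℝ) :
    laplaceFunctional ν (fun p => t * u p) = ∫ ω, Real.exp (-(t * ω.sumFn u)) ∂ν := by
  rw [Literature.MathematicalPhysics.KineticTheory.PointProcess.laplaceFunctional]
  refine integral_congr_ae (ae_of_all _ fun ω => ?_)
  simp only
  rw [sumFn_def, mul_finsum_mem]

/-! ## The blown-up laws: hard core and expectations of linear statistics -/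

/-- Under the blown-up law of a law carried by the hard-sphere domain, configurations are `1`-hard-core almost
surely (`stub_isHardCore_blowUp`). -/
theorem ae_isHardCore_blowUpLaw {σ : ℝ} (hσ : 0 < σ) (φ : T3 → ℝ) {N : ℕ} (Q : Measure (Config (N + 1) (Fin 3) T3))
    [IsProbabilityMeasure Q]
    (hQ : ∀ᵐ z ∂Q, z ∈ hardSphereDomain (Literature.Analysis.FluidPDE.Torus.geometry (Fin 3)) (N + 1)
      (hsDiameter σ N)) :
    ∀ᵐ ω ∂(blowUpLaw σ φ N Q), IsHardCore 1 ω := by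
  rw [blowUpLaw, ae_map_iff (measurable_blowUp _ _).aemeasurable (measurableSet_setOf_isHardCore 1)]
  filter_upwards [(Measure.quasiMeasurePreserving_snd).ae hQ] with p hp
  exact stub_isHardCore_blowUp (hsDiameter_pos hσ _) p.1 hp

/-- **Expectations of linear statistics under the blown-up law.** For `σ > 0`, continuous `φ ≥ 0` with `∫φ > 0`,
a probability law `Q` carried by the hard-sphere domain and `u ∈ C_c(ℝ³ × ℝ³)`: `E_{blowUpLaw σ φ N Q}[∑_{p ∈ ω} u p]
= (∫φ)⁻¹ ∫ φ x · E_Q[∑ᵢ u(blowUpPoint ε_N x zᵢ)] dx` (label sums are configuration sums, Fubini, density `φ/∫φ`). -/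
theorem integral_sumFn_blowUpLaw {σ : ℝ} (hσ : 0 < σ) {φ : T3 → ℝ} (hφ : Continuous φ) (hφ0 : ∀ x, 0 ≤ φ x)
    (hint : 0 < ∫ x, φ x) {N : ℕ} (Q : Measure (Config (N + 1) (Fin 3) T3)) [IsProbabilityMeasure Q]
    (hQ : ∀ᵐ z ∂Q, z ∈ hardSphereDomain (Literature.Analysis.FluidPDE.Torus.geometry (Fin 3)) (N + 1)
      (hsDiameter σ N))
    {u : V3 × V3 → ℝ} (hu : Continuous u) (hcs : HasCompactSupport u) :
    ∫ ω, ω.sumFn u ∂(blowUpLaw σ φ N Q) =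
      (∫ x, φ x)⁻¹ * ∫ x : T3, φ x * ∫ z, (∑ i, u (blowUpPoint (hsDiameter σ N) x (z i))) ∂Q := by
  have hε := hsDiameter_pos hσ N
  haveI := isProbabilityMeasure_weightLaw hφ hφ0 hint
  obtain ⟨B, hB⟩ := hu.bounded_above_of_compact_support hcs
  obtain ⟨F, hF⟩ : ∃ F : T3 × Config (N + 1) (Fin 3) T3 → ℝ,
      ∀ p, F p = ∑ i, u (blowUpPoint (hsDiameter σ N) p.1 (p.2 i)) := ⟨_, fun _ => rfl⟩
  have hFm : Measurable F := by
    rw [show F = fun p => ∑ i, u (blowUpPoint (hsDiameter σ N) p.1 (p.2 i)) from funext hF]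
    exact measurable_labelSum hu.measurable
  have hF1 : ∀ p, ‖F p‖ ≤ (N + 1) * B := fun p => by
    rw [hF]
    refine (norm_sum_le _ _).trans ((Finset.sum_le_sum fun i _ => hB _).trans (le_of_eq ?_))
    rw [Finset.sum_const, Finset.card_univ, Fintype.card_fin, nsmul_eq_mul, Nat.cast_add_one]
  -- (1) transport along the blow-up map: configuration sums are label sums on the hard-sphere domain
  have h1 : ∫ ω, ω.sumFn u ∂(blowUpLaw σ φ N Q) = ∫ p, F p ∂((weightLaw φ).prod Q) := by
    rw [blowUpLaw, integral_map (measurable_blowUp _ _).aemeasurable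
        (measurable_sumFn hu.measurable hcs).aestronglyMeasurable]
    refine integral_congr_ae ?_
    filter_upwards [(Measure.quasiMeasurePreserving_snd).ae hQ] with p hp
    rw [hF, sumFn_def,
      show ((blowUp (hsDiameter σ N) p.1 p.2 : PointConfig (V3 × V3)) : Set (V3 × V3)) =
        Set.range (fun i => blowUpPoint (hsDiameter σ N) p.1 (p.2 i)) from rfl,
      finsum_mem_range (injective_blowUpPoint hε p.1 hp), finsum_eq_sum_of_fintype]
  -- (2) Fubini and the density
  rw [h1, integral_prod _ (Integrable.of_bound hFm.aestronglyMeasurable _ (ae_of_all _ hF1)), weightLaw,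
    integral_withDensity_eq_integral_smul (hφ.measurable.const_mul _).real_toNNReal]
  have hco : ∀ x, ((Real.toNNReal ((∫ y, φ y)⁻¹ * φ x) : ℝ≥0) : ℝ) = (∫ y, φ y)⁻¹ * φ x := fun x =>
    Real.coe_toNNReal _ (mul_nonneg (inv_nonneg.2 hint.le) (hφ0 x))
  simp only [NNReal.smul_def, smul_eq_mul, hco, hF, mul_assoc]
  rw [integral_const_mul]

/-! ## The one-body limit -/

/-- A tangent state of a family of probability laws is a probability law (test the Laplace functionals at `f = 0`;
private copy of the lemma of `…TangentBias.lean`). -/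
private theorem isProbabilityMeasure_tangentState {σ : ℝ} {φ : T3 → ℝ} (hφi : 0 < ∫ x, φ x) {N : ℕ → ℕ}
    {Q : ∀ k, Measure (Config (N k + 1) (Fin 3) T3)} (hQ : ∀ k, IsProbabilityMeasure (Q k)) {ι : ℕ → ℕ}
    {μ : Measure (PointConfig (V3 × V3))} (hμ : IsTangentState σ φ N Q ι μ) : IsProbabilityMeasure μ := by
  have h1 : ∀ k, tangentLaplace σ φ (N (ι k)) (Q (ι k)) (fun _ => 0) = 1 := fun k => by
    haveI := hQ (ι k)
    simp only [tangentLaplace, Finset.sum_const_zero, neg_zero, Real.exp_zero, integral_const, probReal_univ,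
      smul_eq_mul, mul_one]
    exact inv_mul_cancel₀ hφi.ne'
  have h2 := hμ.2 (fun _ => 0) continuous_const HasCompactSupport.zero fun _ => le_rfl
  simp_rw [h1] at h2
  have h3 : laplaceFunctional μ (fun _ => (0 : ℝ)) = 1 := (tendsto_nhds_unique tendsto_const_nhds h2).symm
  have h4 : laplaceFunctional μ (fun _ => (0 : ℝ)) = μ.real univ := by simp [laplaceFunctional]
  rw [h4, measureReal_def] at h3
  exact ⟨(ENNReal.toReal_eq_one_iff _).1 h3⟩

/-- **THE ONE-BODY LIMIT ALONG TANGENT STATES** (registered stub `stub_oneBodyLimit` of line `FirstLemma`, crux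
stmt-AtomisticToContinuum-14135; hypothesis `h₁` of `stub_tangentBiasOfFacts`). Along a tangent state `μ` of a tangent
family, for `h ∈ C_c(ℝ³ × ℝ³)` the linear statistic `ω ↦ ∑_{p ∈ ω} h p` is `μ`-integrable and
`(∫φ)⁻¹ ∫ φ x · E_{Q(ι k)}[∑ᵢ h(blowUpPoint ε x zᵢ)] dx → E_μ[∑_{p ∈ ω} h p]`: the left side is `E_{P_k}[∑ h]` for the
blown-up laws `P_k`, `1`-hard-core a.s., so `∑ h±` are a.s. uniformly bounded while their Laplace transforms converge;
`tendsto_integral_of_tendsto_integral_exp` for `h⁺, h⁻`, and subtract. -/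
theorem stub_oneBodyLimit : ∀ (σ a θ : ℝ) (u₀ : V3) (κ : ℝ), 0 < σ →
      ∀ (φ : T3 → ℝ), Continuous φ → (∀ x, 0 ≤ φ x) → (∀ x, φ x ≤ 1) → 0 < ∫ x, φ x →
      ∀ (N : ℕ → ℕ)
        (Φ : ∀ k, HardSphereFlow (Literature.Analysis.FluidPDE.Torus.geometry (Fin 3)) (hsDiameter σ (N k)) (N k + 1))
        (Q : ∀ k, Measure (Config (N k + 1) (Fin 3) T3)),
        IsTangentFamily σ a θ u₀ κ N Φ Q →
        ∀ (ι : ℕ → ℕ) (μ : Measure (PointConfig (V3 × V3))), IsTangentState σ φ N Q ι μ →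
        ∀ (h : V3 × V3 → ℝ), Continuous h → HasCompactSupport h →
          Integrable (fun ω : PointConfig (V3 × V3) => ω.sumFn h) μ ∧
          Tendsto (fun k => (∫ x, φ x)⁻¹ * ∫ x : T3, φ x *
              ∫ z, (∑ i, h (blowUpPoint (hsDiameter σ (N (ι k))) x (z i))) ∂Q (ι k)) atTop
            (𝓝 (∫ ω, ω.sumFn h ∂μ)) := by
  intro σ a θ u₀ κ hσ φ hφ hφ0 _hφ1 hφi N Φ Q hfam ι μ hμ h hh hhc
  obtain ⟨-, hQprob, hKL, -⟩ := hfam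
  haveI : ∀ k, IsProbabilityMeasure (Q k) := hQprob
  haveI : IsProbabilityMeasure μ := isProbabilityMeasure_tangentState hφi hQprob hμ
  have hD : ∀ k, ∀ᵐ z ∂Q k, z ∈ hardSphereDomain (Literature.Analysis.FluidPDE.Torus.geometry (Fin 3))
      (N k + 1) (hsDiameter σ (N k)) := fun k =>
    ae_mem_hardSphereDomain_of_klDiv_ne_top (ne_top_of_le_ne_top ENNReal.ofReal_ne_top (hKL k))
  -- the blown-up laws along `ι`: probability, hard core, expectations of linear statistics
  obtain ⟨P, hP⟩ : ∃ P : ℕ → Measure (PointConfig (V3 × V3)),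
      ∀ k, P k = blowUpLaw σ φ (N (ι k)) (Q (ι k)) := ⟨_, fun _ => rfl⟩
  haveI := isProbabilityMeasure_weightLaw hφ hφ0 hφi
  have hPprob : ∀ k, IsProbabilityMeasure (P k) := fun k => by
    rw [hP]; exact Measure.isProbabilityMeasure_map (measurable_blowUp _ _).aemeasurable
  have hPcore : ∀ k, ∀ᵐ ω ∂P k, IsHardCore 1 ω := fun k => by
    rw [hP]; exact ae_isHardCore_blowUpLaw hσ φ (Q (ι k)) (hD (ι k))
  have hident : ∀ {u : V3 × V3 → ℝ}, Continuous u → HasCompactSupport u → ∀ k,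
      (∫ x, φ x)⁻¹ * ∫ x : T3, φ x * ∫ z, (∑ i, u (blowUpPoint (hsDiameter σ (N (ι k))) x (z i))) ∂Q (ι k) =
        ∫ ω, ω.sumFn u ∂P k := fun hu hcs k => by
    rw [hP]; exact (integral_sumFn_blowUpLaw hσ hφ hφ0 hφi (Q (ι k)) (hD (ι k)) hu hcs).symm
  have hPint : ∀ {u : V3 × V3 → ℝ}, Continuous u → HasCompactSupport u → ∀ k,
      Integrable (fun ω : PointConfig (V3 × V3) => ω.sumFn u) (P k) := fun hu hcs k => by
    obtain ⟨C, -, hC⟩ := exists_sumFn_bound_of_isHardCore hu hcs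
    haveI := hPprob k
    exact Integrable.of_bound (measurable_sumFn hu.measurable hcs).aestronglyMeasurable C
      ((hPcore k).mono fun ω hω => by rw [Real.norm_eq_abs]; exact hC ω hω)
  -- nonnegative test functions: the abstract lemma
  have hpos : ∀ {u : V3 × V3 → ℝ}, Continuous u → HasCompactSupport u → (∀ p, 0 ≤ u p) →
      Integrable (fun ω : PointConfig (V3 × V3) => ω.sumFn u) μ ∧
        Tendsto (fun k => ∫ ω, ω.sumFn u ∂P k) atTop (𝓝 (∫ ω, ω.sumFn u ∂μ)) := by
    intro u hu hcs hu0
    obtain ⟨C, -, hC⟩ := exists_sumFn_bound_of_isHardCore hu hcs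
    refine tendsto_integral_of_tendsto_integral_exp hPprob (measurable_sumFn hu.measurable hcs)
      (fun ω => sumFn_nonneg ω hu0) (fun k => (hPcore k).mono fun ω hω => (le_abs_self _).trans (hC ω hω))
      fun t ht => ?_
    show Tendsto (fun k => ∫ ω, Real.exp (-(t * ω.sumFn u)) ∂P k) atTop
      (𝓝 (∫ ω, Real.exp (-(t * ω.sumFn u)) ∂μ))
    have htu : Continuous fun p => t * u p := continuous_const.mul hu
    have htuc : HasCompactSupport fun p => t * u p := hcs.mul_left
    have htu0 : ∀ p, 0 ≤ t * u p := fun p => mul_nonneg ht.le (hu0 p)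
    have hconv := hμ.2 _ htu htuc htu0
    rw [laplaceFunctional_const_mul] at hconv
    refine hconv.congr fun k => ?_
    rw [← stub_laplaceFunctional_blowUpLaw hσ hφ hφ0 hφi (Q (ι k)) (hD (ι k)) htu htuc htu0, ← hP,
      laplaceFunctional_const_mul]
  -- signed test functions: split into positive and negative parts
  have hhp : Continuous fun p => max (h p) 0 := hh.max continuous_const
  have hhm : Continuous fun p => max (-h p) 0 := hh.neg.max continuous_const
  obtain ⟨hIp, hTp⟩ := hpos hhp (hasCompactSupport_posPart hhc) fun p => le_max_right _ _
  obtain ⟨hIm, hTm⟩ := hpos hhm (hasCompactSupport_negPart hhc) fun p => le_max_right _ _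
  have hsplit : (fun ω : PointConfig (V3 × V3) => ω.sumFn h) =
      fun ω => ω.sumFn (fun p => max (h p) 0) - ω.sumFn (fun p => max (-h p) 0) :=
    funext fun ω => sumFn_eq_posPart_sub_negPart ω hhc
  refine ⟨by rw [hsplit]; exact hIp.sub hIm, ?_⟩
  have hlim : ∫ ω, ω.sumFn h ∂μ =
      (∫ ω, ω.sumFn (fun p => max (h p) 0) ∂μ) - ∫ ω, ω.sumFn (fun p => max (-h p) 0) ∂μ := by
    rw [hsplit]
    exact integral_sub hIp hIm
  rw [hlim]
  refine (hTp.sub hTm).congr fun k => ?_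
  rw [← integral_sub (hPint hhp (hasCompactSupport_posPart hhc) k) (hPint hhm (hasCompactSupport_negPart hhc) k),
    hident hh hhc k, hsplit]

end Summit.AtomisticToContinuum.HydrodynamicLimit.Theorems.KiferCompactification
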